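import Literature.AnabelianGeometry.EtaleTheta.Discharge.Sec5Thm56EndKnitLevelNForallRoofsGalois
import Literature.AnabelianGeometry.EtaleTheta.Discharge.Sec5ThetaSubquotientProjGaloisPinnedLevelN
import HarnessLib

/-!
# [EtTh] Prop. 5.5 ⊕ Thm. 5.6 (i) at the genuine level-`N` §5 data over `B^temp(Π^tp_X)⁰` — THE KNOT: the subquotient record PRODUCED
# (abc-iut-w5-d051's pinned v2 term), so the node closer carries NO `P`-binder and NO pin binder (proof-only)

S. Mochizuki, *The étale theta function and its Frobenioid-theoretic manifestations*, Publ. RIMS **45** (2009) [MochizukiEtTh2009],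
Thm. 5.6 p.328, proof p.329 (PDF pp.102–103); Prop. 5.5 p.327, proof p.328 (PDF pp.101–102) (transport by ROOFS `S″ → S`, `S″ → S′`);
§5 p.327 (PDF p.101) «these subquotients determine subquotients `Aut_D(D) ↠ Aut^Θ_D(D)`; `(l·Δ_Θ)_D ⊆ Aut^Θ_D(D)`»
[cite: MochizukiEtTh2009, Thm 5.6 p.328 (PDF p.102)] [cite: MochizukiEtTh2009, Prop 5.5 p.327 (PDF p.101)] [cite: MochizukiEtTh2009, §5 p.327 (PDF p.101)].

abc-iut cell, layer L2, seat abc-iut-w6-d077 (gen 9); cone node **EtTh:Thm5.6(i)** (with EtTh:Prop5.5); row «EtTh:Thm5.6(i)/(ii) (w1f) head re-key on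
`IsKummerDetermined`» (abc-iut-L2-lead gen 7, L2 PACE @03 02:56:23Z; CLAIM 02:57:55Z; division with abc-iut-w5-d051's R987 census 03:13:33Z) —
«THM56 TOP KNOT ON v2 — P-ELIMINATION AT 𝔉_N».  PROOF-ONLY (0 definitions; nothing landed is edited or restated).

WHY.  Every Prop. 5.5 ⊕ Thm. 5.6 (i) end knit of the cell at abc-iut-L2-t4's genuine level-`N` data `𝔉_N := ofConnectedTemperoidData h (RD.levelStub ιX) …`
binds a subquotient record `P` («`Aut_D(D) ⊇ pre ↠ (l·Δ_Θ)_D`», §5 p.327) plus TWO PIN EQUATIONS at `B_N^bs` (`hPpre : P.pre = autPre_{q_N, ι_N} ∘ mapAut`,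
`hPproj_pin : P.proj = autProj_{q_N, ι_N} ∘ mapAut`; GAP-LEDGER G-w4d042g3-1 «(Q, P) PACKAGING»).  On abc-iut-L2-t4's v1 record no such term exists
(EMPTY at the root-model stub, p476337; at carriers with a rigid object, p456572), so as typed those closers range over an empty-able type.  On
abc-iut-w6-d079's v2 record (surjectivity at GALOIS objects only — as print uses it) abc-iut-w5-d051 CONSTRUCTED the pinned term AT `𝔉_N`
(`exists_thetaSubquotientProjGalois_pinned_levelStub`, p489319).  THIS FILE feeds that term to the fewest-binder roof-form end knits on the v2 record
(this seat's `Sec5Thm56EndKnitLevelNForallRoofsGalois`) and re-spells the two Prop. 5.2 (iii) pin binders that mentioned `P.proj` on PRINT'S projection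
`autProj_{q_N, ι_N}` (the shape of abc-iut-w4-d042's `exists_coeffMap_levelStub_of_pins`), carrying them back onto `P.proj` through the projection pin
inside the proof.  Result: the node closer no longer quantifies over a subquotient record at all.

* **`exists_rigidityFamily_unique_preserved_ofConnectedTemperoidData_levelN_pinned_modelHyps_forall_roofs_galois`** — at abc-iut-L2-t4's §5 data
  over `B^temp(Π^tp_X)⁰` (any Frobenius-trivial Galois `A_⊙`, with `hH` «`Π^tp_Ÿ ⊆ H_⊙`»);
* (the `Ÿ`-setting instance — abc-iut-w4-d042's `A_⊙^bs := Ÿ`, where `hH` is the theorem `BiKummerSetting.hH_mkOfConnectedTemperoidYdd` — is NOT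
  restated: re-elaborating the `autProj`-spelled pin binders at the `Ÿ` data exceeds the default heartbeat budget at `whnf`, cf. abc-iut-w5-d051's
  note 03:13:33Z; it is the instance `A₀ := connQuotZeroObj _` of the theorem below.)
Conclusion: `∃ P : ThetaSubquotientProjGalois 𝔉_N (IsGaloisObj ·.obj), (P.pre B_N^bs = autPre-pin) ∧ (P.proj B_N^bs = autProj-pin) ∧ ∃ aΨ (natural),
∃ ρ, P.IsKummerDetermined ρ hB ∧ IsFunctorialLinear ρ ∧ (∀ ρ′, … → ρ′ = ρ) ∧ CyclotomicRigidityPreserved 𝔉_N Ψ ρ aΨ`.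
BINDERS THAT REMAIN (all displayed; classification per abc-iut-w5-d051's census 03:09:52Z): the junction data of `ofConnectedTemperoidData` at
`Q := RD.levelStub ιX` {`h`, `odd_l`, `R`, `ιX`, `K'`, `constEmb`(+injective), `hinvc`, `hinvp`, `[RD.iotaN.range.Normal]`} · `hB` (`B_N` theta-saturated)
· the Prop. 5.2 (iii) pin {`η₀`, `hη₀`, `hdies`, `ν`, `hKν`} and the cyclotome dictionary {`H` Facts, `m`, `hme`, `hχX` F-1306} = node EtTh:Prop5.5's own
inputs (GAP G-L2t4-2 / F-0521 class) · Prop. 3.4 (ii) constants {`cnst`, `hP34`, `hΔcnst` G-w5d020-2} · print's roofs {`hroof`, `hmeet`} · `hH`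
(first theorem only) · Thm. 5.6's OWN hypothesis `Ψ` with its normalised root transport {`α`, `β`, `Dp₀`, `hc₁`, `hp₁`, `hDp₀`} (Prop. 5.3 (vi);
produced for every `Ψ` at this base by abc-iut-w6-d047's p479644 under the model hypotheses) · `hnd` ([EtTh] Thm. 3.7 (ii)) · `h218i` ([EtTh]
Cor. 2.18 (i), F-0620; RECLOSED at the Tate datum p468072 / p479283).  GONE vs. every earlier level-`N` closer: `P`, `hPpre`, `hPproj_pin`
(and, as in `_forall_roofs`: `hreach`, `hpull`, `Ψbs`/`eΨ`/`hlin`/`aΨ`/`haΨn`, `e`/`he`/`hPproj`/`hproj`/`hpre`/`hcov′`/`hgeom`/`hLc`/`hLi`, `hD`/`hslim`/`hN`).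

HONEST FRAMING: kernel-checked implications between the cell's typed statements about abc-iut-L2-t4's genuine §5 data, with ONE existential
instantiated at a constructed term; the binders listed above are HYPOTHESES, not asserted; nothing asserts that [EtTh]'s data exist for an actual
curve; [EtTh] is refereed pre-IUT material; nothing here bears on [IUTchIII] Cor. 3.12 — no side is taken; typed ≠ proved; nothing here asserts
abc proved or refuted.
-/

noncomputable section

namespace Literature.AnabelianGeometry.EtaleTheta

open CategoryTheory Opposite FrobenioidCyclotomicRigidity Literature.AlgebraicGeometry.Frobenioids
  Literature.AnabelianGeometry.SemiGraphs Literature.AnabelianGeometry.SemiGraphs.GaloisObjects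
open FrobenioidCyclotomicRigidity (ThetaSubquotientProjGalois)

universe u₀ v₀ w' v₁ u₁

namespace ThetaFrobenioid

section ConnectedMerged

variable {K : Type u₀} [Field K] {X : SemiGraphs.TemperedArithmeticGroup.{u₀} K} {D₀ : Type u₀} [Category.{v₀} D₀]
  {V : FrdIMonoidStub.{max u₀ w'}} {T₀ : RealifiedDivisorMonoids (D₀ := D₀) V}
  {VD : FrdICatStub.{u₀ + 1, u₀, max u₀ w'} (ConnectedPart (BTemp X.Pi))}
  {tf : TemperedFrobenioid T₀ (ConnectedPart (BTemp X.Pi)) VD} {hZ : tf.monoidType = MonoidType.Z}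
  {hP : ∀ A : (ConnectedPart (BTemp X.Pi))ᵒᵖ, IsPerfect (tf.Φ.carrier A)}
  {NH : Subgroup (Field.absoluteGaloisGroup K) → tf.category → ℕ+ → Prop} {A₀ : tf.category}
  {hA₀ : PreFrobenioid.IsFrobeniusTrivial tf.toElem A₀} {hA₀' : SemiGraphs.IsGaloisObj A₀.base.obj}
  {lv N : ℕ+} {l' : ℕ} {RD : RigidData.{max u₀ w'} N l'}
  {pullFrac : ∀ {A A' : (BiKummerSetting.mkOfConnectedTemperoid X tf hZ hP NH A₀ hA₀ hA₀').C} (_ : A' ⟶ A),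
    (BiKummerSetting.mkOfConnectedTemperoid X tf hZ hP NH A₀ hA₀ hA₀').biratUnits A →
      (BiKummerSetting.mkOfConnectedTemperoid X tf hZ hP NH A₀ hA₀ hA₀').biratUnits A'}
  {θ : (BiKummerSetting.mkOfConnectedTemperoid X tf hZ hP NH A₀ hA₀ hA₀').biratUnits
    (BiKummerSetting.mkOfConnectedTemperoid X tf hZ hP NH A₀ hA₀ hA₀').Aodot}
  {Bl : (BiKummerSetting.mkOfConnectedTemperoid X tf hZ hP NH A₀ hA₀ hA₀').C}
  {Pl : (BiKummerSetting.mkOfConnectedTemperoid X tf hZ hP NH A₀ hA₀ hA₀').FractionPair θ Bl}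
  {Rl : (BiKummerSetting.mkOfConnectedTemperoid X tf hZ hP NH A₀ hA₀ hA₀').NthRoot θ Pl lv pullFrac}
  (h : ModelFrobenioid.Hypotheses tf.divisorMonoid tf.ratFnFunctor)
  (odd_l : Odd (lv : ℕ))
  (R : (BiKummerSetting.mkOfConnectedTemperoid X tf hZ hP NH A₀ hA₀ hA₀').NthRoot Rl.root Rl.pair N pullFrac)
  (ιX : RD.PiX ≃ₜ* X.Pi) (K' : Type (max u₀ w')) [Field K'] (constEmb : K'ˣ →* tf.biratUnitsModel R.BN)
  (constEmb_injective : Function.Injective constEmb)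
  (hinvc : ∀ g : Aut R.AN.base,
    pull tf.divisorMonoid g.hom (ModelFrobenioid.div R.pair.num) = ModelFrobenioid.div R.pair.num)
  (hinvp : ∀ y : RD.PiX, y ∈ RD.PiYdd →
    pull tf.divisorMonoid ((BiKummerSetting.mkOfConnectedTemperoid X tf hZ hP NH A₀ hA₀ hA₀').galoisSurj R.AN.base
      R.αData.isGalois (ιX y)).hom (ModelFrobenioid.div R.pair.den) = ModelFrobenioid.div R.pair.den)
  [RD.iotaN.range.Normal]

include h in
/-- **THE KNOT — [EtTh] Prop. 5.5 ⊕ Thm. 5.6 (i) at the genuine level-`N` §5 data over `B^temp(Π^tp_X)⁰` with NO subquotient-record binder and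
NO pin binder** (cone node EtTh:Thm5.6(i); GAP-LEDGER G-w4d042g3-1's (Q, P)-packaging binder RETIRED here): for EVERY self-equivalence `Ψ`
with the normalised root transport (Prop. 5.3 (vi)), the model hypothesis «`Φ` non-dilating» ([EtTh] Thm. 3.7 (ii)), [EtTh] Cor. 2.18 (i), print's
ROOFS, the Prop. 5.2 (iii) pin `(η₀, ν)` and the cyclotome dictionary `m` (both now spelled on PRINT'S projection `autProj_{q_N, ι_N} : Aut_D(B_N^bs)
⊇ autPre ↠ (l·Δ_Θ)_{B_N}`, §5 p.327, no `P` mentioned) and Prop. 3.4 (ii) constants: THERE IS a subquotient record `P` on the v2 (Galois-only)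
interface whose domain and projection at `B_N^bs` ARE print's `autPre` / `autProj` (both pin equations — abc-iut-w5-d051's pinned term, p489319),
the Δ-transport `aΨ` of `Ψ` (natural), and a rigidity family `ρ` that is Kummer-determined on `B_N` through that `P` (Prop. 5.5), functorial for
linear morphisms, UNIQUE as such, and PRESERVED by `Ψ` (Thm. 5.6: `CyclotomicRigidityPreserved Ψ ρ aΨ`).  Proof: abc-iut-w5-d051's pinned term
+ the Prop. 5.2 (iii) binders carried from `autProj` onto `P.proj` through the projection pin + this file's `…_modelHyps_forall_roofs_galois`.
[cite: MochizukiEtTh2009, Thm 5.6 p.328 (PDF p.102); Prop 5.5 p.327 (PDF p.101); §5 p.327 (PDF p.101)] -/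
theorem exists_rigidityFamily_unique_preserved_ofConnectedTemperoidData_levelN_pinned_modelHyps_forall_roofs_galois
    -- Prop 5.5 side (η / ν pin, reachability, stub laws)
    (hB : (ofConnectedTemperoidData h (RD.levelStub ιX) odd_l R ιX K' constEmb constEmb_injective hinvc hinvp).IsThetaSaturated (ofConnectedTemperoidData h (RD.levelStub ιX) odd_l R ιX K' constEmb constEmb_injective hinvc hinvp).BN)
    -- NO subquotient-record binder and NO pin binder: the v2 record `P` is PRODUCED inside the proof (abc-iut-w5-d051's pinned term, p489319)
    {η₀ : RD.PiYdd → RD.mu} (hη₀ : η₀ ∈ RD.thetaCocycles)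
    (hdies : ∀ k : RD.PiYdd, rhoOfBiKummerData R ιX k = 1 → η₀ k = 1)
    (ν : (ofConnectedTemperoidData h (RD.levelStub ιX) odd_l R ιX K' constEmb constEmb_injective hinvc hinvp).lDeltaModN (ofConnectedTemperoidData h (RD.levelStub ιX) odd_l R ιX K' constEmb constEmb_injective hinvc hinvp).BN ≃* (ofConnectedTemperoidData h (RD.levelStub ιX) odd_l R ιX K' constEmb constEmb_injective hinvc hinvp).muTorsion (ofConnectedTemperoidData h (RD.levelStub ιX) odd_l R ιX K' constEmb constEmb_injective hinvc hinvp).BN (ofConnectedTemperoidData h (RD.levelStub ιX) odd_l R ιX K' constEmb constEmb_injective hinvc hinvp).N)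
    -- hKν with the coefficient map ELIMINATED (abc-iut-w4-d042) and — new here — SUBQUOTIENT-RECORD-FREE: «η ∘ ρ = e ∘ η₀» reads
    -- «η(ρ k) = mk (autProj_{q_N, ι_N} (ρ k'))» whenever `thetaMod k' = η₀ k` (print's own projection `Aut_D(B_N^bs) ↠ (l·Δ_Θ)_{B_N}`, §5 p.327)
    (hKν : ∀ η : (ofConnectedTemperoidData h (RD.levelStub ιX) odd_l R ιX K' constEmb constEmb_injective hinvc hinvp).HB → (ofConnectedTemperoidData h (RD.levelStub ιX) odd_l R ιX K' constEmb constEmb_injective hinvc hinvp).lDeltaModN (ofConnectedTemperoidData h (RD.levelStub ιX) odd_l R ιX K' constEmb constEmb_injective hinvc hinvp).BN,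
      (∀ (k k' : RD.PiYdd) (hk' : (k' : RD.PiX) ∈ RD.lDeltaTheta) (hm' : ((Functor.mapAut R.BN.base (connectedObjects (BTemp X.Pi)).ι).comp (rhoOfBiKummerData R ιX)) k' ∈
            ThetaSubquotient.autPre (RD.qN ιX) RD.iotaN R.BN.base.obj),
          RD.thetaMod ⟨k', hk'⟩ = η₀ k →
            η ⟨rhoOfBiKummerData R ιX k, Subgroup.mem_map_of_mem _ k.2⟩ =
              (QuotientGroup.mk (ThetaSubquotient.autProj (RD.qN ιX) RD.iotaN R.BN.base.obj ⟨_, hm'⟩) : (ofConnectedTemperoidData h (RD.levelStub ιX) odd_l R ιX K' constEmb constEmb_injective hinvc hinvp).lDeltaModN (ofConnectedTemperoidData h (RD.levelStub ιX) odd_l R ιX K' constEmb constEmb_injective hinvc hinvp).BN)) →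
        FrobenioidThetaBiKummer.ThetaPairKummerClass (ofConnectedTemperoidData h (RD.levelStub ιX) odd_l R ιX K' constEmb constEmb_injective hinvc hinvp) η ν)
    -- T56-L09b: Prop 3.4 (ii) constants + the origin clause «cnst kills Ker aug» (G-w5d020-2)
    {Dcnst : Type u₁} [Category.{v₁} Dcnst] {cnst : D₀ ⥤ Dcnst} (hP34 : RealifiedDivisorMonoids.Prop34Cnst T₀ cnst)
    (hΔcnst : ∀ δ ∈ RD.aug.ker,
      cnst.map (tf.base.map (rhoOfBiKummerData R ιX δ).hom) = 𝟙 (cnst.obj (tf.base.obj R.BN.base)))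
    -- print's ROOFS (replacing `hreach`): one roof per theta-saturated object, and two roofs of `T` meet
    (hroof : ∀ T : (BiKummerSetting.mkOfConnectedTemperoid X tf hZ hP NH A₀ hA₀ hA₀').C, (ofConnectedTemperoidData h (RD.levelStub ιX) odd_l R ιX K' constEmb constEmb_injective hinvc hinvp).IsThetaSaturated T →
      ∃ (R' : (BiKummerSetting.mkOfConnectedTemperoid X tf hZ hP NH A₀ hA₀ hA₀').C) (_ : (ofConnectedTemperoidData h (RD.levelStub ιX) odd_l R ιX K' constEmb constEmb_injective hinvc hinvp).IsThetaSaturated R') (a : R' ⟶ T) (b : R' ⟶ (ofConnectedTemperoidData h (RD.levelStub ιX) odd_l R ιX K' constEmb constEmb_injective hinvc hinvp).BN),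
        (ofConnectedTemperoidData h (RD.levelStub ιX) odd_l R ιX K' constEmb constEmb_injective hinvc hinvp).IsLinear a ∧ (ofConnectedTemperoidData h (RD.levelStub ιX) odd_l R ιX K' constEmb constEmb_injective hinvc hinvp).IsLinear b ∧
        Function.Surjective ((ofConnectedTemperoidData h (RD.levelStub ιX) odd_l R ιX K' constEmb constEmb_injective hinvc hinvp).lDeltaModNMap a) ∧ Function.Injective ((ofConnectedTemperoidData h (RD.levelStub ιX) odd_l R ιX K' constEmb constEmb_injective hinvc hinvp).muTorsionPull a (ofConnectedTemperoidData h (RD.levelStub ιX) odd_l R ιX K' constEmb constEmb_injective hinvc hinvp).N) ∧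
        Function.Surjective ((ofConnectedTemperoidData h (RD.levelStub ιX) odd_l R ιX K' constEmb constEmb_injective hinvc hinvp).lDeltaModNMap b) ∧ Function.Injective ((ofConnectedTemperoidData h (RD.levelStub ιX) odd_l R ιX K' constEmb constEmb_injective hinvc hinvp).muTorsionPull b (ofConnectedTemperoidData h (RD.levelStub ιX) odd_l R ιX K' constEmb constEmb_injective hinvc hinvp).N))
    (hmeet : ∀ (T : (BiKummerSetting.mkOfConnectedTemperoid X tf hZ hP NH A₀ hA₀ hA₀').C), (ofConnectedTemperoidData h (RD.levelStub ιX) odd_l R ιX K' constEmb constEmb_injective hinvc hinvp).IsThetaSaturated T →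
      ∀ (R₁ : (BiKummerSetting.mkOfConnectedTemperoid X tf hZ hP NH A₀ hA₀ hA₀').C), (ofConnectedTemperoidData h (RD.levelStub ιX) odd_l R ιX K' constEmb constEmb_injective hinvc hinvp).IsThetaSaturated R₁ → ∀ (a : R₁ ⟶ T), (ofConnectedTemperoidData h (RD.levelStub ιX) odd_l R ιX K' constEmb constEmb_injective hinvc hinvp).IsLinear a →
      ∀ (R₂ : (BiKummerSetting.mkOfConnectedTemperoid X tf hZ hP NH A₀ hA₀ hA₀').C), (ofConnectedTemperoidData h (RD.levelStub ιX) odd_l R ιX K' constEmb constEmb_injective hinvc hinvp).IsThetaSaturated R₂ → ∀ (a' : R₂ ⟶ T), (ofConnectedTemperoidData h (RD.levelStub ιX) odd_l R ιX K' constEmb constEmb_injective hinvc hinvp).IsLinear a' →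
      ∃ (R₀ : (BiKummerSetting.mkOfConnectedTemperoid X tf hZ hP NH A₀ hA₀ hA₀').C) (_ : (ofConnectedTemperoidData h (RD.levelStub ιX) odd_l R ιX K' constEmb constEmb_injective hinvc hinvp).IsThetaSaturated R₀) (c : R₀ ⟶ R₁) (c' : R₀ ⟶ R₂),
        (ofConnectedTemperoidData h (RD.levelStub ιX) odd_l R ιX K' constEmb constEmb_injective hinvc hinvp).IsLinear c ∧ (ofConnectedTemperoidData h (RD.levelStub ιX) odd_l R ιX K' constEmb constEmb_injective hinvc hinvp).IsLinear c' ∧ (ofConnectedTemperoidData h (RD.levelStub ιX) odd_l R ιX K' constEmb constEmb_injective hinvc hinvp).base.map (c ≫ a) = (ofConnectedTemperoidData h (RD.levelStub ιX) odd_l R ιX K' constEmb constEmb_injective hinvc hinvp).base.map (c' ≫ a') ∧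
        Function.Surjective ((ofConnectedTemperoidData h (RD.levelStub ιX) odd_l R ιX K' constEmb constEmb_injective hinvc hinvp).lDeltaModNMap c') ∧ Function.Injective ((ofConnectedTemperoidData h (RD.levelStub ιX) odd_l R ιX K' constEmb constEmb_injective hinvc hinvp).muTorsionPull c' (ofConnectedTemperoidData h (RD.levelStub ιX) odd_l R ιX K' constEmb constEmb_injective hinvc hinvp).N))
    -- hKR (G-L6t23-3) by abc-iut-w4-d099's PIN route (p-file Sec5ThetaSectionCompatOfKummerClass): «Prop 5.2 (iii) enters ONCE» —
    -- the (η₀, ν) pin above + Facts + the cyclotome dictionary m with m ∘ ν ∘ e = id + cyclotomic-character compatibility (F-1306)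
    (H : (ofConnectedTemperoidData h (RD.levelStub ιX) odd_l R ιX K' constEmb constEmb_injective hinvc hinvp).Facts)
    (m : (ofConnectedTemperoidData h (RD.levelStub ιX) odd_l R ιX K' constEmb constEmb_injective hinvc hinvp).muTorsion (ofConnectedTemperoidData h (RD.levelStub ιX) odd_l R ιX K' constEmb constEmb_injective hinvc hinvp).BN (ofConnectedTemperoidData h (RD.levelStub ιX) odd_l R ιX K' constEmb constEmb_injective hinvc hinvp).N ≃* RD.mu)
    -- hme with the coefficient map ELIMINATED (abc-iut-w4-d042), SUBQUOTIENT-RECORD-FREE: `m (ν (mk (autProj_{q_N, ι_N} (ρ k)))) = thetaMod k` on `Π^tp_Ÿ ∩ (l·Δ_Θ)`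
    (hme : ∀ (k : RD.PiYdd) (hk : (k : RD.PiX) ∈ RD.lDeltaTheta) (hm : ((Functor.mapAut R.BN.base (connectedObjects (BTemp X.Pi)).ι).comp (rhoOfBiKummerData R ιX)) k ∈
        ThetaSubquotient.autPre (RD.qN ιX) RD.iotaN R.BN.base.obj),
      m (ν (QuotientGroup.mk (ThetaSubquotient.autProj (RD.qN ιX) RD.iotaN R.BN.base.obj ⟨_, hm⟩) : (ofConnectedTemperoidData h (RD.levelStub ιX) odd_l R ιX K' constEmb constEmb_injective hinvc hinvp).lDeltaModN (ofConnectedTemperoidData h (RD.levelStub ιX) odd_l R ιX K' constEmb constEmb_injective hinvc hinvp).BN)) = RD.thetaMod ⟨k, hk⟩)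
    (hχX : (ofConnectedTemperoidData h (RD.levelStub ιX) odd_l R ιX K' constEmb constEmb_injective hinvc hinvp).CyclotomicCharacterCompatX RD.toThetaEnvData (MulEquiv.refl _) m)
    -- hdiff reduced to Π^tp_Ÿ ⊆ H_⊙ (`hfrac`, `haut` are THEOREMS here: [FrdI] Thm 5.2 (ii) dictionary, abc-iut-L2-t9/t4)
    (hH : ∀ y : RD.PiX, y ∈ RD.PiYdd → ιX y ∈ (BiKummerSetting.mkOfConnectedTemperoid X tf hZ hP NH A₀ hA₀ hA₀').Hodot)
    -- Thm 5.6 side: Ψ, its base shadow, Δ-transport and μ-pull data (abc-iut-L2-d4)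
    (Ψ : (BiKummerSetting.mkOfConnectedTemperoid X tf hZ hP NH A₀ hA₀ hA₀').C ≌ (BiKummerSetting.mkOfConnectedTemperoid X tf hZ hP NH A₀ hA₀ hA₀').C)
    -- the NORMALISED Thm 5.7 transport (D_c = 1, e = 1: abc-iut-L2-d4 T1 + abc-iut-w5-d245 `capCupTransport_normalise`)
    (α : Ψ.functor.obj (ofConnectedTemperoidData h (RD.levelStub ιX) odd_l R ιX K' constEmb constEmb_injective hinvc hinvp).AN ≅ (ofConnectedTemperoidData h (RD.levelStub ιX) odd_l R ιX K' constEmb constEmb_injective hinvc hinvp).AN) (β : Ψ.functor.obj (ofConnectedTemperoidData h (RD.levelStub ιX) odd_l R ιX K' constEmb constEmb_injective hinvc hinvp).BN ≅ (ofConnectedTemperoidData h (RD.levelStub ιX) odd_l R ιX K' constEmb constEmb_injective hinvc hinvp).BN) {Dp₀ : Aut (ofConnectedTemperoidData h (RD.levelStub ιX) odd_l R ιX K' constEmb constEmb_injective hinvc hinvp).BN}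
    (hc₁ : α.inv ≫ Ψ.functor.map (ofConnectedTemperoidData h (RD.levelStub ιX) odd_l R ιX K' constEmb constEmb_injective hinvc hinvp).sCap ≫ β.hom = (ofConnectedTemperoidData h (RD.levelStub ιX) odd_l R ιX K' constEmb constEmb_injective hinvc hinvp).sCap)
    (hp₁ : α.inv ≫ Ψ.functor.map (ofConnectedTemperoidData h (RD.levelStub ιX) odd_l R ιX K' constEmb constEmb_injective hinvc hinvp).sCup ≫ β.hom = (ofConnectedTemperoidData h (RD.levelStub ιX) odd_l R ιX K' constEmb constEmb_injective hinvc hinvp).sCup ≫ Dp₀.hom) (hDp₀ : Dp₀ ∈ (ofConnectedTemperoidData h (RD.levelStub ιX) odd_l R ιX K' constEmb constEmb_injective hinvc hinvp).units (ofConnectedTemperoidData h (RD.levelStub ιX) odd_l R ιX K' constEmb constEmb_injective hinvc hinvp).BN)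
    -- of the four MODEL HYPOTHESES of [FrdI] Thm 3.4 (iii)/(v) only `Φ` non-dilating remains ([EtTh] Thm 3.7 (ii)); `D` of FSM-type, `D` slim, `∃` non-group-like are THEOREMS
    (hnd : IsNonDilatingOn tf.divisorMonoid)
    -- [EtTh] Cor 2.18 (i): the theta-related subquotients Π^tp_Ÿ, (l·Δ_Θ), … of Π^tp_X are CHARACTERISTIC (abc-iut-L2-t2's
    -- `RigidData.Cor218_i`, F-0620; discharged at the model data by abc-iut-L2-t8/L6) — supplies hP24/hγL for EVERY γ
    (h218i : RD.Cor218_i) :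
    ∃ P : ThetaSubquotientProjGalois (ofConnectedTemperoidData h (RD.levelStub ιX) odd_l R ιX K' constEmb constEmb_injective hinvc hinvp) fun E => SemiGraphs.IsGaloisObj E.obj,
      P.pre R.BN.base = (ThetaSubquotient.autPre (RD.qN ιX) RD.iotaN R.BN.base.obj).comap
          (Functor.mapAut R.BN.base (connectedObjects (BTemp X.Pi)).ι) ∧
      (∀ (σ : P.pre R.BN.base) (τ : ThetaSubquotient.autPre (RD.qN ιX) RD.iotaN R.BN.base.obj),
          Functor.mapAut R.BN.base (connectedObjects (BTemp X.Pi)).ι (σ : Aut R.BN.base) = (τ : Aut R.BN.base.obj) →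
            (P.proj R.BN.base σ : ThetaSubquotient.LDelta (RD.qN ιX) RD.iotaN R.BN.base.obj) =
              ThetaSubquotient.autProj (RD.qN ιX) RD.iotaN R.BN.base.obj τ) ∧
    ∃ aΨ : ∀ A : (BiKummerSetting.mkOfConnectedTemperoid X tf hZ hP NH A₀ hA₀ hA₀').C, (ofConnectedTemperoidData h (RD.levelStub ιX) odd_l R ιX K' constEmb constEmb_injective hinvc hinvp).lDeltaModN A ≃* (ofConnectedTemperoidData h (RD.levelStub ιX) odd_l R ιX K' constEmb constEmb_injective hinvc hinvp).lDeltaModN (Ψ.functor.obj A),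
      (∀ ⦃A A' : (BiKummerSetting.mkOfConnectedTemperoid X tf hZ hP NH A₀ hA₀ hA₀').C⦄ (ψ : A ⟶ A') (x : (ofConnectedTemperoidData h (RD.levelStub ιX) odd_l R ιX K' constEmb constEmb_injective hinvc hinvp).lDeltaModN A),
        aΨ A' ((ofConnectedTemperoidData h (RD.levelStub ιX) odd_l R ιX K' constEmb constEmb_injective hinvc hinvp).lDeltaModNMap ψ x) = (ofConnectedTemperoidData h (RD.levelStub ιX) odd_l R ιX K' constEmb constEmb_injective hinvc hinvp).lDeltaModNMap (Ψ.functor.map ψ) (aΨ A x)) ∧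
    ∃ ρ : RigidityFamily (ofConnectedTemperoidData h (RD.levelStub ιX) odd_l R ιX K' constEmb constEmb_injective hinvc hinvp), P.IsKummerDetermined ρ hB ∧ IsFunctorialLinear (ofConnectedTemperoidData h (RD.levelStub ιX) odd_l R ιX K' constEmb constEmb_injective hinvc hinvp) ρ ∧
      (∀ ρ' : RigidityFamily (ofConnectedTemperoidData h (RD.levelStub ιX) odd_l R ιX K' constEmb constEmb_injective hinvc hinvp), P.IsKummerDetermined ρ' hB → IsFunctorialLinear (ofConnectedTemperoidData h (RD.levelStub ιX) odd_l R ιX K' constEmb constEmb_injective hinvc hinvp) ρ' → ρ' = ρ) ∧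
      CyclotomicRigidityPreserved (ofConnectedTemperoidData h (RD.levelStub ιX) odd_l R ιX K' constEmb constEmb_injective hinvc hinvp) Ψ ρ
        aΨ := by
  -- the PINNED v2 subquotient term at this data (abc-iut-w5-d051 `exists_thetaSubquotientProjGalois_pinned_levelStub`, p489319):
  -- `pre F := (autPre q_N ι_N F.obj).comap (mapAut F ι)`, `proj F := autProj q_N ι_N F.obj ∘ mapAut` — both pins BY CONSTRUCTION
  obtain ⟨P, hpre, hproj⟩ := exists_thetaSubquotientProjGalois_pinned_levelStub.{u₀, v₀, w'} h odd_l R ιX K' constEmb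
    constEmb_injective hinvc hinvp
  have hPpre : P.pre R.BN.base = (ThetaSubquotient.autPre (RD.qN ιX) RD.iotaN R.BN.base.obj).comap
      (Functor.mapAut R.BN.base (connectedObjects (BTemp X.Pi)).ι) := hpre R.BN.base
  have hPproj_pin : ∀ (σ : P.pre R.BN.base) (τ : ThetaSubquotient.autPre (RD.qN ιX) RD.iotaN R.BN.base.obj),
      Functor.mapAut R.BN.base (connectedObjects (BTemp X.Pi)).ι (σ : Aut R.BN.base) = (τ : Aut R.BN.base.obj) →
        (P.proj R.BN.base σ : ThetaSubquotient.LDelta (RD.qN ιX) RD.iotaN R.BN.base.obj) =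
          ThetaSubquotient.autProj (RD.qN ιX) RD.iotaN R.BN.base.obj τ :=
    fun σ τ hστ => hproj R.BN.base σ τ hστ
  -- the Prop 5.2 (iii) pin binders, carried from print's `autProj` onto `P.proj` through the projection pin
  have hKνP : ∀ η : (ofConnectedTemperoidData h (RD.levelStub ιX) odd_l R ιX K' constEmb constEmb_injective hinvc hinvp).HB → (ofConnectedTemperoidData h (RD.levelStub ιX) odd_l R ιX K' constEmb constEmb_injective hinvc hinvp).lDeltaModN (ofConnectedTemperoidData h (RD.levelStub ιX) odd_l R ιX K' constEmb constEmb_injective hinvc hinvp).BN,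
      (∀ (k k' : RD.PiYdd) (hk' : (k' : RD.PiX) ∈ RD.lDeltaTheta) (hm' : rhoOfBiKummerData R ιX k' ∈ P.pre _),
          RD.thetaMod ⟨k', hk'⟩ = η₀ k →
            η ⟨rhoOfBiKummerData R ιX k, Subgroup.mem_map_of_mem _ k.2⟩ =
              (QuotientGroup.mk (P.proj _ ⟨rhoOfBiKummerData R ιX k', hm'⟩) : (ofConnectedTemperoidData h (RD.levelStub ιX) odd_l R ιX K' constEmb constEmb_injective hinvc hinvp).lDeltaModN (ofConnectedTemperoidData h (RD.levelStub ιX) odd_l R ιX K' constEmb constEmb_injective hinvc hinvp).BN)) →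
        FrobenioidThetaBiKummer.ThetaPairKummerClass (ofConnectedTemperoidData h (RD.levelStub ιX) odd_l R ιX K' constEmb constEmb_injective hinvc hinvp) η ν := by
    intro η hη
    refine hKν η (fun k k' hk' hm' hθ => ?_)
    have hmP : rhoOfBiKummerData R ιX k' ∈ P.pre R.BN.base := by
      rw [hPpre]
      exact hm'
    exact (hη k k' hk' hmP hθ).trans (congrArg QuotientGroup.mk (hPproj_pin ⟨rhoOfBiKummerData R ιX k', hmP⟩ ⟨_, hm'⟩ rfl))
  have hmeP : ∀ (k : RD.PiYdd) (hk : (k : RD.PiX) ∈ RD.lDeltaTheta) (hm : rhoOfBiKummerData R ιX k ∈ P.pre _),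
      m (ν (QuotientGroup.mk (P.proj _ ⟨rhoOfBiKummerData R ιX k, hm⟩) : (ofConnectedTemperoidData h (RD.levelStub ιX) odd_l R ιX K' constEmb constEmb_injective hinvc hinvp).lDeltaModN (ofConnectedTemperoidData h (RD.levelStub ιX) odd_l R ιX K' constEmb constEmb_injective hinvc hinvp).BN)) = RD.thetaMod ⟨k, hk⟩ := by
    intro k hk hm
    have hm' : ((Functor.mapAut R.BN.base (connectedObjects (BTemp X.Pi)).ι).comp (rhoOfBiKummerData R ιX)) k ∈
        ThetaSubquotient.autPre (RD.qN ιX) RD.iotaN R.BN.base.obj :=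
      mapAut_rho_mem_autPre_of_coe_mem_lDeltaTheta R ιX k hk
    have hpin : (QuotientGroup.mk (P.proj _ ⟨rhoOfBiKummerData R ιX k, hm⟩) : (ofConnectedTemperoidData h (RD.levelStub ιX) odd_l R ιX K' constEmb constEmb_injective hinvc hinvp).lDeltaModN (ofConnectedTemperoidData h (RD.levelStub ιX) odd_l R ιX K' constEmb constEmb_injective hinvc hinvp).BN) =
        (QuotientGroup.mk (ThetaSubquotient.autProj (RD.qN ιX) RD.iotaN R.BN.base.obj ⟨_, hm'⟩) : (ofConnectedTemperoidData h (RD.levelStub ιX) odd_l R ιX K' constEmb constEmb_injective hinvc hinvp).lDeltaModN (ofConnectedTemperoidData h (RD.levelStub ιX) odd_l R ιX K' constEmb constEmb_injective hinvc hinvp).BN) :=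
      congrArg QuotientGroup.mk (hPproj_pin ⟨rhoOfBiKummerData R ιX k, hm⟩ ⟨_, hm'⟩ rfl)
    exact (congrArg (fun z => m (ν z)) hpin).trans (hme k hk hm')
  -- the fewest-binder ROOF-form end knit on the v2 record (`Sec5Thm56EndKnitLevelNForallRoofsGalois`), fed the produced `P` and its pins (closed-type step)
  have hmain := exists_rigidityFamily_unique_preserved_ofConnectedTemperoidData_levelN_projPin_modelHyps_forall_roofs_galois.{u₀, v₀, w', v₁, u₁} h odd_l R ιX K'
    constEmb constEmb_injective hinvc hinvp hB P hPpre hPproj_pin hη₀ hdies ν hKνP hP34 hΔcnst hroof hmeet H m hmeP hχX hH Ψ α β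
    hc₁ hp₁ hDp₀ hnd h218i
  exact ⟨P, hPpre, hPproj_pin, hmain⟩

end ConnectedMerged

end ThetaFrobenioid

end Literature.AnabelianGeometry.EtaleTheta

end
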